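import Literature.NumberTheory.Automorphic.ShimuraCurveCartanLevelHeckeCosets
import Literature.NumberTheory.Automorphic.EichlerSubidealCount
import Literature.NumberTheory.Automorphic.EichlerOrderLocallyMaximal
import Literature.NumberTheory.Automorphic.BrandtModuleDictionary
import Literature.NumberTheory.Automorphic.QuaternionInvolutionToolkit
import Literature.NumberTheory.Automorphic.QuaternionOrderIntegral
import HarnessLib

/-!
# The residue map `P → M₂(𝔽_ℓ)` of an order that is maximal at a split prime `ℓ`

Topic `NumberTheory/Automorphic`; theorems only (no definition, no named fact, no instance, no
`sorry`). For a quaternion algebra `B/ℚ` split at a prime `ℓ` (`ℚ_ℓ ⊗ B ≅ M₂(ℚ_ℓ)`), a maximal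
order `O₁` and an order `P ⊆ O₁` with `O₁ ⊆ P₍ℓ₎` (so `P₍ℓ₎ = O₁,₍ℓ₎`: `P` is maximal AT `ℓ`), there
is a ring homomorphism

  `red : P → M₂(𝔽_ℓ)`, ONTO, with kernel `ℓ P`, and `det (red x) = nrd x (mod ℓ)`

(`exists_residueMatrixHom`). It is the tree's reduction `O₁ → M₂(ℤ ∕ ℓ)` of a maximal order at a
split prime (`exists_modPow_reduction`, `EichlerOrderPadicSplitting.lean`, `k = 1`: Vignéras II §2
Thm. 2.3 (1) read modulo `ℓ`) restricted to `P`: onto and with kernel `ℓ P` because every element of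
`O₁` has a multiple by an integer prime to `ℓ` inside `P` (Bézout); the determinant clause is
derived from the interface alone through Cayley–Hamilton in `M₂(𝔽_ℓ)` (`x² = t x − n` on `P`;
a non-scalar `red x` has characteristic polynomial `X² − t̄ X + n̄`, a scalar `red x = a` forces
`x ≡ a (mod ℓ P)` and `nrd x ≡ a² (mod ℓ)`).

For a Cartan-level Shimura curve datum `X : CartanLevelCurveData D M C` (any `D`) and a prime
`ℓ ∤ D M`, `ℓ ∉ C`, EVERY order `P` between the Cartan order `O` and the Eichler hull `O₀` is maximal
at `ℓ` (`IsEichlerOrder.exists_isMaximalZOrder_localAt_eq` and `[O₀ : O] = ∏_C q²` prime to `ℓ`), and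
`B` is split at `ℓ` (`ramifiedPlaces_eq`), whence `CartanLevelCurveData.exists_residueMatrixHom`: such a
`red : P → M₂(𝔽_ℓ)` exists — in particular for the cover order `O₀' = O + n_q O₀` of the BSD cell's
crux 24801 (the `ℙ¹(𝔽_ℓ)` identification of the `ℓ + 1` Hecke cosets, input of (T6) of the
inert-Hecke certificate, is read off from `red`: the coset of `α` ↦ `ker (red α)`). Filed by the BSD
cell `bsd-stepL` (seat `defn-ty1` g42). Nothing arithmetic is asserted; BSD is proved for no curve.

## References

* M.-F. Vignéras, *Arithmétique des algèbres de quaternions*, LNM 800 (1980), Ch. II §2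
  Thm. 2.3 (1) (p. 35 of the PDF: «les ordres maximaux de M(2,K) sont conjugués à M(2,R)»);
  Ch. III §5 Prop. 5.1 and propriétés locales. [cite: VignerasLNM800, Ch. II §2 Thm. 2.3 (1) and Ch. III §5 Prop. 5.1]
* D. Kohen, A. Pacetti, *Heegner points on Cartan non-split curves*, Canad. J. Math. 68 (2016),
  §1.1, §1.3 (Cartan non-split orders and their Hecke operators away from the level).
  [cite: KohenPacetti2016, §1.1 and §1.3]
-/

noncomputable section

open scoped NumberField TensorProduct

universe u

namespace Literature.NumberTheory.Automorphic

open IsDedekindDomain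

section Residue

variable {B : Type u} [Ring B] [Algebra ℚ B] [IsQuaternionAlgebra ℚ B]

/-- Bézout in a `ℤ`-module: `m • u ∈ P`, `n • u ∈ P`, `gcd(m, n) = 1` give `u ∈ P`. [folklore] -/
private theorem mem_of_coprime_smul_mem' {V : Type*} [AddCommGroup V] {P : Submodule ℤ V} {u : V}
    {m n : ℕ} (hmn : m.Coprime n) (hm : (m : ℤ) • u ∈ P) (hn : (n : ℤ) • u ∈ P) : u ∈ P := by
  obtain ⟨s, t, hst⟩ := Nat.isCoprime_iff_coprime.mpr hmn
  have e : u = s • ((m : ℤ) • u) + t • ((n : ℤ) • u) := by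
    rw [smul_smul, smul_smul, ← add_smul, hst, one_smul]
  rw [e]
  exact P.add_mem (P.smul_mem s hm) (P.smul_mem t hn)

/-- Cayley–Hamilton for `2 × 2` matrices: `A² = tr(A) A − det(A)`. [folklore] -/
private theorem fin_two_mul_self_eq {R : Type*} [CommRing R] (A : Matrix (Fin 2) (Fin 2) R) :
    A * A = A.trace • A - A.det • (1 : Matrix (Fin 2) (Fin 2) R) := by
  ext i j
  fin_cases i <;> fin_cases j <;>
    simp [Matrix.mul_apply, Fin.sum_univ_two, Matrix.trace_fin_two, Matrix.det_fin_two] <;> ring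

/-- **The residue map of an order maximal at a split prime** (Vignéras II §2 Thm. 2.3 (1) read
modulo `ℓ`). For `B` split at `ℓ`, a maximal order `O₁` and an order `P ⊆ O₁` with `O₁ ⊆ P₍ℓ₎`:
a ring map `red : P → M₂(𝔽_ℓ)`, onto, with kernel `ℓ P`, and `det (red x) = nrd x (mod ℓ)`.
[cite: VignerasLNM800, Ch. II §2 Thm. 2.3 (1) and Ch. III §5 Prop. 5.1] -/
theorem exists_residueMatrixHom {O₁ : Submodule ℤ B} (hO₁ : IsMaximalZOrder O₁) {p : ℕ} [hp : Fact p.Prime]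
    (hsplit : Nonempty (ℚ_[p] ⊗[ℚ] B ≃ₐ[ℚ_[p]] Matrix (Fin 2) (Fin 2) ℚ_[p]))
    {P : Submodule ℤ B} (hP : Brandt.IsOrder B P) (hPO₁ : P ≤ O₁) (hloc : O₁ ≤ localAt p P)
    (S : Subring B) (hS : ∀ x, x ∈ S ↔ x ∈ P) :
    ∃ red : S →+* Matrix (Fin 2) (Fin 2) (ZMod p), Function.Surjective red ∧
      (∀ x : S, red x = 0 ↔ ∃ y ∈ P, (x : B) = (p : ℤ) • y) ∧
      (∀ x : S, ∃ n : ℤ, reducedNorm ℚ B (x : B) = n ∧ (red x).det = (n : ZMod p)) := by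
  classical
  have hpp : p.Prime := hp.out
  obtain ⟨ψ, hadd, hmul, hone, hsurj, hker⟩ := exists_modPow_reduction hO₁ hsplit 1
  -- transport `ZMod (p ^ 1) ≃ ZMod p`
  set E : Matrix (Fin 2) (Fin 2) (ZMod (p ^ 1)) ≃+* Matrix (Fin 2) (Fin 2) (ZMod p) :=
    (ZMod.ringEquivCongr (pow_one p)).mapMatrix with hE
  set ψ' : B → Matrix (Fin 2) (Fin 2) (ZMod p) := fun x => E (ψ x) with hψ'
  have hS' : ∀ x : S, (x : B) ∈ P := fun x => (hS x).mp x.2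
  have hadd' : ∀ x ∈ P, ∀ y ∈ P, ψ' (x + y) = ψ' x + ψ' y := fun x hx y hy => by
    simp only [hψ', hadd x (hPO₁ hx) y (hPO₁ hy), map_add]
  have hmul' : ∀ x ∈ P, ∀ y ∈ P, ψ' (x * y) = ψ' x * ψ' y := fun x hx y hy => by
    simp only [hψ', hmul x (hPO₁ hx) y (hPO₁ hy), map_mul]
  have hone' : ψ' 1 = 1 := by simp only [hψ', hone, map_one]
  have hzero' : ψ' 0 = 0 := by
    have h := hadd' 0 P.zero_mem 0 P.zero_mem
    rw [add_zero] at h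
    exact left_eq_add.mp h
  -- kernel on `P`
  have hker' : ∀ x ∈ P, ψ' x = 0 ↔ ∃ y ∈ P, x = (p : ℤ) • y := fun x hx => by
    rw [hψ']
    change E (ψ x) = 0 ↔ _
    rw [map_eq_zero_iff E E.injective, hker x (hPO₁ hx), pow_one]
    constructor
    · rintro ⟨y, hy, rfl⟩
      obtain ⟨m, hm0, hm, hmy⟩ := hloc hy
      exact ⟨y, mem_of_coprime_smul_mem' hm.symm hx hmy, rfl⟩
    · rintro ⟨y, hy, rfl⟩
      exact ⟨y, hPO₁ hy, rfl⟩
  -- the residue map structure on `P` (for `map_zsmul`, `map_sub`)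
  have hR : IsMatrixResidueMap P p ψ' := by
    refine ⟨hadd', hmul', hone', fun m => ?_, hker'⟩
    obtain ⟨x, hx, hψx⟩ := hsurj (E.symm m)
    obtain ⟨n, hn0, hn, hnx⟩ := hloc hx
    obtain ⟨c, d, hcd⟩ := exists_mul_add_mul_pow_eq_one hn 1
    refine ⟨(c * (n : ℤ)) • x, by rw [mul_smul]; exact P.smul_mem c hnx, ?_⟩
    have hR₁ : IsMatrixResidueMap O₁ p ψ' :=
      ⟨fun x hx y hy => by simp only [hψ', hadd x hx y hy, map_add],
       fun x hx y hy => by simp only [hψ', hmul x hx y hy, map_mul], hone',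
       fun m => by obtain ⟨x, hx, h⟩ := hsurj (E.symm m); exact ⟨x, hx, by simp only [hψ', h, RingEquiv.apply_symm_apply]⟩,
       fun x hx => by
        rw [hψ']
        change E (ψ x) = 0 ↔ _
        rw [map_eq_zero_iff E E.injective, hker x hx, pow_one]⟩
    rw [hR₁.map_zsmul hx, ← Int.cast_smul_eq_zsmul (ZMod p)]
    have hcm : ((c * (n : ℤ) : ℤ) : ZMod p) = 1 := by
      have h1 : ((c * (n : ℤ) + d * (p : ℤ) ^ 1 : ℤ) : ZMod p) = 1 := by rw [hcd, Int.cast_one]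
      rw [← h1]
      push_cast
      simp
    rw [hcm, one_smul, hψ']
    change E (ψ x) = m
    rw [hψx, RingEquiv.apply_symm_apply]
  -- the ring homomorphism on `S`
  let red : S →+* Matrix (Fin 2) (Fin 2) (ZMod p) :=
    { toFun := fun x => ψ' (x : B)
      map_one' := hone'
      map_mul' := fun x y => hmul' _ (hS' x) _ (hS' y)
      map_zero' := hzero'
      map_add' := fun x y => hadd' _ (hS' x) _ (hS' y) }
  have hred : ∀ x : S, red x = ψ' (x : B) := fun x => rfl
  refine ⟨red, ?_, fun x => by rw [hred]; exact hker' _ (hS' x), ?_⟩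
  · -- onto
    intro m
    obtain ⟨x, hx, hψx⟩ := hR.surj m
    exact ⟨⟨x, (hS x).mpr hx⟩, hψx⟩
  · -- determinant: Cayley–Hamilton
    intro x
    have hxP : (x : B) ∈ P := hS' x
    obtain ⟨t, n, ht, hn⟩ := hP.exists_int_reducedTrace_reducedNorm hxP
    refine ⟨n, hn, ?_⟩
    rw [hred]
    set A : Matrix (Fin 2) (Fin 2) (ZMod p) := ψ' (x : B) with hA
    -- `x² = t x − n` in `B`, hence `A² = t̄ A − n̄`
    have hxx : (x : B) * x = (t : ℤ) • (x : B) - (n : ℤ) • (1 : B) := by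
      rw [mul_self_eq_smul_sub ℚ (x : B), ht, hn, Algebra.algebraMap_eq_smul_one,
        Int.cast_smul_eq_zsmul, Int.cast_smul_eq_zsmul]
    have hAA : A * A = (t : ZMod p) • A - (n : ZMod p) • (1 : Matrix (Fin 2) (Fin 2) (ZMod p)) := by
      rw [hA, ← hmul' _ hxP _ hxP, hxx, hR.map_sub (P.smul_mem _ hxP) (P.smul_mem _ hP.one_mem),
        hR.map_zsmul hxP, hR.map_zsmul hP.one_mem, hone', ← Int.cast_smul_eq_zsmul (ZMod p),
        ← Int.cast_smul_eq_zsmul (ZMod p) n]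
    have hCH := fin_two_mul_self_eq A
    -- `(tr A − t̄) • A = (det A − n̄) • 1`
    have hkey : (A.trace - (t : ZMod p)) • A = (A.det - (n : ZMod p)) • (1 : Matrix (Fin 2) (Fin 2) (ZMod p)) := by
      rw [sub_smul, sub_smul]
      have e1 : A.trace • A = A * A + A.det • (1 : Matrix (Fin 2) (Fin 2) (ZMod p)) := by
        rw [hCH, sub_add_cancel]
      rw [e1, hAA]
      abel
    by_cases htr : A.trace = (t : ZMod p)
    · rw [htr, sub_self, zero_smul] at hkey
      have h00 := congrArg (fun N : Matrix (Fin 2) (Fin 2) (ZMod p) => N 0 0) hkey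
      simp only [Matrix.zero_apply, Matrix.smul_apply, Matrix.one_apply_eq, smul_eq_mul, mul_one] at h00
      linear_combination -h00
    · -- `A` is the scalar `a`; then `x ≡ a (mod p P)` and `nrd x ≡ a² (mod p)`
      have hc : A.trace - (t : ZMod p) ≠ 0 := sub_ne_zero.mpr htr
      set a : ZMod p := (A.trace - (t : ZMod p))⁻¹ * (A.det - (n : ZMod p)) with ha
      have hAa : A = a • (1 : Matrix (Fin 2) (Fin 2) (ZMod p)) := by
        have h := congrArg (fun N : Matrix (Fin 2) (Fin 2) (ZMod p) => (A.trace - (t : ZMod p))⁻¹ • N) hkey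
        simp only [smul_smul, inv_mul_cancel₀ hc, one_smul] at h
        rw [h, ha]
      -- an integer lift `a'` of `a`
      set a' : ℤ := (a.cast : ℤ) with ha'
      have ha'a : ((a' : ℤ) : ZMod p) = a := by rw [ha', ZMod.intCast_zmod_cast]
      have hxa : ψ' ((x : B) - (a' : ℤ) • (1 : B)) = 0 := by
        rw [hR.map_sub hxP (P.smul_mem _ hP.one_mem), hR.map_zsmul hP.one_mem, hone',
          ← Int.cast_smul_eq_zsmul (ZMod p), ha'a, ← hA, hAa, sub_self]
      obtain ⟨y, hy, hxy⟩ := (hker' _ (P.sub_mem hxP (P.smul_mem _ hP.one_mem))).mp hxa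
      obtain ⟨ty, ny, hty, hny⟩ := hP.exists_int_reducedTrace_reducedNorm hy
      -- `nrd x = a'² + p² n_y + a' p t_y`
      have hx_eq : (x : B) = (a' : ℚ) • (1 : B) + (p : ℚ) • y := by
        rw [eq_add_of_sub_eq' hxy, ← Int.cast_smul_eq_zsmul ℚ, ← Int.cast_smul_eq_zsmul ℚ (p : ℤ),
          Int.cast_natCast]
      have hnQ : (n : ℚ) = (a' : ℚ) ^ 2 + (p : ℚ) ^ 2 * ny + (a' : ℚ) * p * ty := by
        rw [← hn, hx_eq, reducedNorm_add ℚ, reducedNorm_smul ℚ, reducedNorm_smul ℚ, reducedNorm_one ℚ B,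
          hny, standardInvolution_smul ℚ, smul_mul_assoc, one_mul, map_smul, map_smul,
          reducedTrace_standardInvolution ℚ, hty, smul_eq_mul, smul_eq_mul]
        ring
      have hnZ : n = a' ^ 2 + (p : ℤ) ^ 2 * ny + a' * p * ty := by exact_mod_cast hnQ
      have hnmod : (n : ZMod p) = ((a' : ℤ) : ZMod p) ^ 2 := by
        rw [hnZ]
        push_cast
        rw [ZMod.natCast_self]
        ring
      rw [hnmod, ha'a, hAa, Matrix.det_smul, Matrix.det_one, mul_one, Fintype.card_fin]

end Residue

/-! ### Cartan-level Shimura curve data: every order between `O` and `O₀` is maximal at a good prime -/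

namespace CartanLevelCurveData

variable {D M : ℕ} {C : Finset ℕ} (X : CartanLevelCurveData D M C)

/-- `B` is split at every prime `ℓ ∤ D`: `ℚ_ℓ ⊗ B ≅ M₂(ℚ_ℓ)` (the ramification clause
`ramifiedPlaces_eq` of the datum and the tree's `nonempty_algEquiv_padic_of_isSplitAt`).
[cite: VignerasLNM800, Ch. III §3 (Ram(H)) and Ch. II §1 Thm. 1.1] -/
theorem nonempty_algEquiv_padic_of_not_dvd {ℓ : ℕ} [Fact ℓ.Prime] (hℓD : ¬ ℓ ∣ D) :
    Nonempty (ℚ_[ℓ] ⊗[ℚ] X.B ≃ₐ[ℚ_[ℓ]] Matrix (Fin 2) (Fin 2) ℚ_[ℓ]) := by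
  have hℓ : ℓ.Prime := Fact.out
  set v : HeightOneSpectrum (𝓞 ℚ) := (Rat.HeightOneSpectrum.primesEquiv (R := 𝓞 ℚ)).symm ⟨ℓ, hℓ⟩
    with hv
  have hvℓ : ((Rat.HeightOneSpectrum.primesEquiv v : Nat.Primes) : ℕ) = ℓ := by
    rw [hv, Equiv.apply_symm_apply]
  have hsplit : IsSplitAt X.B v := by
    by_contra hns
    have h : v ∈ ramifiedPlaces ℚ X.B := hns
    rw [X.ramifiedPlaces_eq, Set.mem_setOf_eq, hvℓ] at h
    exact hℓD h
  exact nonempty_algEquiv_padic_of_isSplitAt X.B v hsplit ℓ hvℓ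

/-- **The residue map `P → M₂(𝔽_ℓ)` at a good prime `ℓ ∤ D M`, `ℓ ∉ C`, for any order `P` between the
Cartan order `O` and its Eichler hull `O₀`** (e.g. the cover order `O + n_q O₀`): onto, kernel `ℓ P`,
`det ∘ red = nrd (mod ℓ)`. (`O₀` is an Eichler order of level `M`, locally maximal at `ℓ ∤ M`;
`[O₀ : O] = ∏_C q²` is prime to `ℓ`, so `P₍ℓ₎ = O₀,₍ℓ₎`; `B` splits at `ℓ ∤ D`.)
[cite: VignerasLNM800, Ch. II §2 Thm. 2.3 (1) and Ch. III §5 Prop. 5.1] [cite: KohenPacetti2016, §1.1 and §1.3] -/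
theorem exists_residueMatrixHom_of_le (hM : 0 < M) {ℓ : ℕ} [Fact ℓ.Prime] (hℓD : ¬ ℓ ∣ D)
    (hℓM : ¬ ℓ ∣ M) (hℓC : ∀ q ∈ C, q ≠ ℓ) {P : Submodule ℤ X.B} (hP : Brandt.IsOrder X.B P)
    (hOP : X.O ≤ P) (hPO₀ : P ≤ X.O₀) (S : Subring X.B) (hS : ∀ x, x ∈ S ↔ x ∈ P) :
    ∃ red : S →+* Matrix (Fin 2) (Fin 2) (ZMod ℓ), Function.Surjective red ∧
      (∀ x : S, red x = 0 ↔ ∃ y ∈ P, (x : X.B) = (ℓ : ℤ) • y) ∧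
      (∀ x : S, ∃ n : ℤ, reducedNorm ℚ X.B (x : X.B) = n ∧ (red x).det = (n : ZMod ℓ)) := by
  have hℓ : ℓ.Prime := Fact.out
  have hE : IsEichlerOrder X.O₀ M := isEichlerOrder_iff_brandt.mpr X.isEichlerOrder
  obtain ⟨O₁, hO₁, hO₀O₁, hloc₀⟩ := hE.exists_isMaximalZOrder_localAt_eq hM.ne' hℓ hℓM
  -- `localAt ℓ X.O₀ = localAt ℓ P` (index `∏ q²`, prime to `ℓ`)
  have hN0 : (∏ q ∈ C, q ^ 2 : ℕ) ≠ 0 :=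
    Finset.prod_ne_zero_iff.mpr fun q hq => pow_ne_zero _ (X.coprime q hq).1.ne_zero
  have hNℓ : (∏ q ∈ C, q ^ 2).Coprime ℓ :=
    Nat.Coprime.prod_left fun q hq =>
      Nat.Coprime.pow_left 2 ((Nat.coprime_primes (X.coprime q hq).1 hℓ).mpr (hℓC q hq))
  have hlocP : localAt ℓ X.O₀ = localAt ℓ P :=
    localAt_eq_of_smul_le hPO₀ hN0 hNℓ fun x hx => hOP (by
      rw [Finset.prod_pow, pow_two, Nat.cast_mul, mul_smul]
      exact X.O.smul_mem _ (X.smul_mem x hx))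
  refine exists_residueMatrixHom hO₁ (X.nonempty_algEquiv_padic_of_not_dvd hℓD) hP
    (hPO₀.trans hO₀O₁) (fun x hx => ?_) S hS
  rw [← hlocP, hloc₀]
  exact le_localAt ℓ O₁ hx

end CartanLevelCurveData

end Literature.NumberTheory.Automorphic

end
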